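import Literature.Analysis.UnboundedOperators.SelfAdjointResolvent
import Literature.Analysis.UnboundedOperators.LumerPhillipsRangeCondition
import HarnessLib

/-!
# A self-adjoint operator bounded above generates a quasi-contractive C₀-semigroup
  (`D = D†`, `⟪Dx, x⟫ ≤ ω‖x‖²` ⇒ `e^{tD}` with `‖e^{tD}‖ ≤ e^{ωt}`; Reed–Simon I Thm. VIII.3 + Engel–Nagel II 3.15)

Analysis/UnboundedOperators proofs-layer file (theorems only, no definitions, no named facts), for Mathlib's
`LinearPMap` self-adjointness (`IsSelfAdjoint D ↔ D† = D`) as used in `SelfAdjointResolvent.lean`. That file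
proves `Ran(D − z) = H` for NON-REAL `z` from the bound `|Im z|‖x‖ ≤ ‖Dx − zx‖`. Here the same closed-range +
orthogonal-complement argument is run at a REAL point under an assumed lower bound `c‖x‖ ≤ ‖Dx − μx‖`
(`c > 0`), which a semibounded operator has away from its numerical range; combined with
`LumerPhillipsRangeCondition` (range condition at one point) and `LumerPhillipsQuasi` (numerical range):

* `isClosed_range_subSMul_of_bound`, `orthogonal_range_subSMul_eq_bot_of_bound`,
  `subSMul_surjective_of_bound` — `Ran(D − μ) = H` for real `μ` with `c‖x‖ ≤ ‖Dx − μx‖`;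
* `isQuasiDissipativeData_of_isSelfAdjoint` — `D = D†`, `Re⟪Dx, x⟫ ≤ ω‖x‖²` ⇒ quasi-dissipative data;
* **`exists_c0Semigroup_of_isSelfAdjoint`** — `∃ T`, `‖T(t)‖ ≤ e^{ωt}`, `T.generator = D` (unique by
  `C0Semigroup.eq_of_generator_eq`); `exists_c0Semigroup_of_isSelfAdjoint_nonpos` — `D ≤ 0` ⇒ contraction
  semigroup (the heat semigroup of a nonpositive self-adjoint operator).

## References

* M. Reed, B. Simon, *Methods of Modern Mathematical Physics I* (1980), Thm. VIII.3 (proof). [ReedSimonI1980]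
* K.-J. Engel, R. Nagel, *One-Parameter Semigroups for Linear Evolution Equations* (2000), Ch. II
  Prop. 3.14, Thm. 3.15, Cor. 3.6. [EngelNagel2000]
-/

noncomputable section

open _root_.LinearPMap _root_.Filter _root_.Topology
open scoped InnerProductSpace ComplexConjugate NNReal

namespace Literature.Analysis.UnboundedOperators

variable {H : Type*} [NormedAddCommGroup H] [InnerProductSpace ℂ H] [CompleteSpace H]
variable {D : H →ₗ.[ℂ] H}

/-- The range of `D − z` is closed when `D` is self-adjoint (hence closed) and `c‖x‖ ≤ ‖Dx − zx‖` with `c > 0`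
(closed operator bounded below). [cite: ReedSimonI1980, Thm VIII.3 (proof)] -/
theorem isClosed_range_subSMul_of_bound (hD : IsSelfAdjoint D) (z : ℂ) {c : ℝ} (hc : 0 < c)
    (hb : ∀ x : D.domain, c * ‖(x : H)‖ ≤ ‖(D x : H) - z • (x : H)‖) :
    IsClosed (LinearMap.range (subSMul D z) : Set H) := by
  have hcl : D.IsClosed := hD.isClosed
  refine IsSeqClosed.isClosed ?_
  intro u y hu huy
  choose x hx using fun n => (LinearMap.mem_range.1 (hu n))
  -- the `x n` form a Cauchy sequence
  have hlip : ∀ n m, ‖(x n : H) - (x m : H)‖ ≤ c⁻¹ * ‖u n - u m‖ := by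
    intro n m
    have h := hb (x n - x m)
    have h' : (D (x n - x m) : H) - z • ((x n - x m : D.domain) : H) = u n - u m := by
      rw [← subSMul_apply, LinearMap.map_sub, hx n, hx m]
    rw [h'] at h
    rw [Submodule.coe_sub] at h
    rw [le_inv_mul_iff₀' hc]; linarith
  have hcu : CauchySeq u := huy.cauchySeq
  have hcx : CauchySeq fun n => (x n : H) := by
    rw [Metric.cauchySeq_iff] at hcu ⊢
    intro ε hε
    obtain ⟨N, hN⟩ := hcu (c * ε) (by positivity)
    refine ⟨N, fun n hn m hm => ?_⟩
    rw [dist_eq_norm]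
    calc ‖(x n : H) - (x m : H)‖ ≤ c⁻¹ * ‖u n - u m‖ := hlip n m
      _ < c⁻¹ * (c * ε) := by
          gcongr; rw [← dist_eq_norm]; exact hN n hn m hm
      _ = ε := by field_simp
  obtain ⟨x₀, hx₀⟩ := cauchySeq_tendsto_of_complete hcx
  have hDx : Tendsto (fun n => (D (x n) : H)) atTop (𝓝 (y + z • x₀)) := by
    have : ∀ n, (D (x n) : H) = u n + z • (x n : H) := by
      intro n
      have := hx n
      rw [subSMul_apply] at this
      rw [← this]; abel
    simp_rw [this]
    exact huy.add (hx₀.const_smul z)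
  have hmem : ∀ n, ((x n : H), (D (x n) : H)) ∈ (D.graph : Set (H × H)) := fun n =>
    (LinearPMap.mem_graph_iff _).2 ⟨x n, rfl, rfl⟩
  have hlim : ((x₀, y + z • x₀) : H × H) ∈ (D.graph : Set (H × H)) :=
    hcl.mem_of_tendsto (hx₀.prodMk_nhds hDx) (Eventually.of_forall hmem)
  rw [SetLike.mem_coe, LinearPMap.mem_graph_iff] at hlim
  obtain ⟨w, hw1, hw2⟩ := hlim
  simp only at hw1 hw2
  refine ⟨w, ?_⟩
  change (D w : H) - z • (w : H) = y
  rw [hw2, hw1]; abel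

/-- The range of `D − μ` (`μ` real) is dense when `c‖x‖ ≤ ‖Dx − μx‖`, `c > 0`: its orthogonal complement is
`ker (D − μ) = 0`. [cite: ReedSimonI1980, Thm VIII.3 (proof)] -/
theorem orthogonal_range_subSMul_eq_bot_of_bound (hD : IsSelfAdjoint D) (μ : ℝ) {c : ℝ} (hc : 0 < c)
    (hb : ∀ x : D.domain, c * ‖(x : H)‖ ≤ ‖(D x : H) - (μ : ℂ) • (x : H)‖) :
    (LinearMap.range (subSMul D μ))ᗮ = ⊥ := by
  have hd : Dense (D.domain : Set H) := hD.dense_domain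
  have heq : D† = D := (LinearPMap.isSelfAdjoint_def).1 hD
  rw [Submodule.eq_bot_iff]
  intro y hy
  rw [Submodule.mem_orthogonal'] at hy
  have hyx : ∀ x : D.domain, ⟪y, (D x : H)⟫_ℂ = ⟪(starRingEnd ℂ (μ : ℂ)) • y, (x : H)⟫_ℂ := by
    intro x
    have h := hy (subSMul D μ x) (LinearMap.mem_range_self _ _)
    rw [subSMul_apply, inner_sub_right, inner_smul_right, sub_eq_zero] at h
    rw [h, inner_smul_left, Complex.conj_conj]
  have hydom : y ∈ D†.domain :=
    mem_adjoint_domain_of_exists y ⟨(starRingEnd ℂ (μ : ℂ)) • y, fun x => (hyx x).symm⟩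
  have hval : D† ⟨y, hydom⟩ = (starRingEnd ℂ (μ : ℂ)) • y :=
    adjoint_apply_eq hd ⟨y, hydom⟩ fun x => (hyx x).symm
  have hydom' : y ∈ D.domain := by rw [← heq]; exact hydom
  have hval' : (D ⟨y, hydom'⟩ : H) = (μ : ℂ) • y := by
    rw [← Complex.conj_ofReal μ, ← hval]; exact ((le_of_eq heq).2 rfl).symm
  have h := hb ⟨y, hydom'⟩
  rw [hval'] at h
  simp only [sub_self, norm_zero] at h
  have : ‖y‖ = 0 := by nlinarith [norm_nonneg y]
  exact norm_eq_zero.1 this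

/-- **`D − μ` maps `dom D` ONTO `H`** for a self-adjoint `D` and a real `μ` with `c‖x‖ ≤ ‖Dx − μx‖`, `c > 0`.
[cite: ReedSimonI1980, Thm VIII.3] -/
theorem subSMul_surjective_of_bound (hD : IsSelfAdjoint D) (μ : ℝ) {c : ℝ} (hc : 0 < c)
    (hb : ∀ x : D.domain, c * ‖(x : H)‖ ≤ ‖(D x : H) - (μ : ℂ) • (x : H)‖) :
    Function.Surjective (subSMul D μ) := by
  have h1 := isClosed_range_subSMul_of_bound hD (μ : ℂ) hc hb
  have h2 := orthogonal_range_subSMul_eq_bot_of_bound hD μ hc hb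
  rw [← Submodule.topologicalClosure_eq_top_iff] at h2
  rw [IsClosed.submodule_topologicalClosure_eq h1] at h2
  exact LinearMap.range_eq_top.1 h2

/-- **Quasi-dissipative data of a self-adjoint operator bounded above**: `D = D†` and `Re⟪Dx, x⟫ ≤ ω‖x‖²` on
`D(D)` ⇒ dense domain, `(λ − ω)‖x‖ ≤ ‖λx − Dx‖` and `λ − D` onto for `λ > ω` (onto at `λ₀ = ω + 1` by
`subSMul_surjective_of_bound`, then everywhere by `LumerPhillipsRangeCondition`). [cite: EngelNagel2000, Ch. II Prop. 3.14] -/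
theorem isQuasiDissipativeData_of_isSelfAdjoint (hD : IsSelfAdjoint D) {ω : ℝ}
    (hre : ∀ x : D.domain, (⟪(D x : H), (x : H)⟫_ℂ).re ≤ ω * ‖(x : H)‖ ^ 2) :
    HilleYosida.IsQuasiDissipativeData D ω := by
  have hdiss := fun x => HilleYosida.quasiDissipative_of_re_inner_le hre (ω + 1) x
  have hb : ∀ x : D.domain, 1 * ‖(x : H)‖ ≤ ‖(D x : H) - ((ω + 1 : ℝ) : ℂ) • (x : H)‖ := fun x => by
    have h := hdiss x
    rw [add_sub_cancel_left] at h
    rwa [norm_sub_rev]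
  have hsurj : ∀ y : H, ∃ x : D.domain, ((ω + 1 : ℝ) : ℂ) • (x : H) - D x = y := fun y => by
    obtain ⟨x, hx⟩ := subSMul_surjective_of_bound hD (ω + 1) one_pos hb (-y)
    refine ⟨x, ?_⟩
    rw [subSMul_apply] at hx
    rw [← neg_neg y, ← hx, neg_sub]
  exact HilleYosida.IsQuasiDissipativeData.of_re_inner_le_of_surj_at hD.dense_domain hre (lt_add_one ω) hsurj

/-- **A SELF-ADJOINT OPERATOR BOUNDED ABOVE GENERATES A QUASI-CONTRACTIVE C₀-SEMIGROUP**: `D = D†`,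
`Re⟪Dx, x⟫ ≤ ω‖x‖²` on `D(D)` ⇒ `∃ T : C0Semigroup ℂ H`, `‖T(t)‖ ≤ e^{ωt}`, `T.generator = D` (`T = e^{tD}`;
unique by `C0Semigroup.eq_of_generator_eq`). [cite: EngelNagel2000, Ch. II Thm. 3.15] -/
theorem exists_c0Semigroup_of_isSelfAdjoint (hD : IsSelfAdjoint D) {ω : ℝ}
    (hre : ∀ x : D.domain, (⟪(D x : H), (x : H)⟫_ℂ).re ≤ ω * ‖(x : H)‖ ^ 2) :
    ∃ T : C0Semigroup ℂ H, (∀ t : ℝ≥0, ‖T.app t‖ ≤ Real.exp (ω * t)) ∧ T.generator = D := by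
  obtain ⟨T, hT, -, hgen⟩ := (isQuasiDissipativeData_of_isSelfAdjoint hD hre).exists_c0Semigroup
  exact ⟨T, hT, hgen⟩

/-- **Nonpositive self-adjoint operators generate contraction semigroups** (`D = D† ≤ 0` ⇒ `‖e^{tD}‖ ≤ 1`).
[cite: EngelNagel2000, Ch. II Thm. 3.15] -/
theorem exists_c0Semigroup_of_isSelfAdjoint_nonpos (hD : IsSelfAdjoint D)
    (hre : ∀ x : D.domain, (⟪(D x : H), (x : H)⟫_ℂ).re ≤ 0) :
    ∃ T : C0Semigroup ℂ H, T.IsContraction ∧ T.generator = D := by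
  obtain ⟨T, hT, hgen⟩ := exists_c0Semigroup_of_isSelfAdjoint hD (ω := 0) (fun x => by rw [zero_mul]; exact hre x)
  exact ⟨T, fun t => by simpa using hT t, hgen⟩

end Literature.Analysis.UnboundedOperators
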